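import Mathlib
import Summits.PneNP.PneNP.Theorems.ClusUniversalCertificateCoordBlkDefs
import Summits.PneNP.PneNP.Theorems.ClusUniversalCertificateCoordBook

/-!
# Route ClusUniversalCertificate, crux `UniversalCertAll` — path `coord` (PEEL form): registered stub `stub_cBookBlk`

Stub file for `stmt-PneNP-19683` (cell pnp-ideate, route `ClusUniversalCertificate`, rung F-N1; path `coord` of pnp-ideate-p1,
skeletons v7 sha16 d87d5ac2 / v8 sha16 f469cf6a; objects of record `ClusUniversalCertificateCoordDefs.lean` p516754 and
`ClusUniversalCertificateCoordBlkDefs.lean`, namespace `…Theorems.ClusCoord`): **`stub_cBookBlk`** — the BLOCK-LAYER BOOKKEEPING step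
of the peel induction with mixed block sizes.  Deleting the whole block `k` maps `𝔽₂^M → 𝔽₂^{M'}` along the order embedding
`kemb` of the coordinates outside block `k`, with block map `blk ∘ kemb` (block `k` becomes EMPTY); a block layer family `L` of
`(Y, k)` covers each fibre with its multiplicity.  Pure bookkeeping:

* `bsize (blk ∘ kemb) k = 0` and `bsize (blk ∘ kemb) j = bsize blk j` for `j ≠ k` (`kemb` is a bijection onto the coordinates
  outside block `k`), so `Σ_j (bsize blk j − 1) = Σ_j (bsize' j − 1) + bsize blk k`;
* for `j ≠ k` the zero pattern of block `j` is unchanged: `Σ_S Z_j(S) = Z_j(Y)` (the generic double counting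
  `ClusCoordBook.list_sum_card_filter_eq`); block `k` of a member point is empty, so `Z_k(S) = |S|` with weight `2^0 = 1` and
  `Σ_S |S| = |Y|`;
* hence the members' mixed certificates plus the block layer inequality `D(Y) ≤ Σ_S D(S) + (bsize k − 1)|Y| + 2^{bsize k} Z_k(Y)`
  give the mixed certificate of `Y`.

FRONTIER rung F-N1 (a combinatorial certificate about affine flats in `𝔽₂^M`); the path's conjecture (`stub_peelZeroRare`) and the
crux are OPEN; nothing here bears on P vs NP.
-/

set_option linter.dupNamespace false -- `Summit.PneNP.PneNP.…`: summit = sub-problem name (D-0017 single-conjunct layout)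

namespace Summit.PneNP.PneNP.Theorems.ClusCoordBookBlk

open Finset
open Summit.PneNP.PneNP.Theorems.ClusCoord (acodim dsum bsize zcount UCMix kemb IsBLayerFamily BLayerIneq)
open Summit.PneNP.PneNP.Theorems.ClusCoordBook (list_sum_map_finset_sum list_sum_map_le list_sum_map_sub list_sum_map_mul
  list_sum_card_filter_eq)

variable {M M' n : ℕ}

/-! ## The embedding of the coordinates outside block `k` -/

/-- Every coordinate in the image of `kemb` lies outside block `k`. -/
theorem blk_kemb_ne (blk : Fin M → Fin n) (k : Fin n) (h : (univ.filter fun i => blk i ≠ k).card = M') (l : Fin M') :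
    blk (kemb blk k M' h l) ≠ k := by
  have hm : kemb blk k M' h l ∈ (univ.filter fun i => blk i ≠ k) := by
    unfold kemb
    exact Finset.orderEmbOfFin_mem _ _ _
  exact (Finset.mem_filter.1 hm).2

/-- Every coordinate outside block `k` is in the image of `kemb`. -/
theorem exists_kemb_eq (blk : Fin M → Fin n) (k : Fin n) (h : (univ.filter fun i => blk i ≠ k).card = M') (i : Fin M)
    (hi : blk i ≠ k) : ∃ l : Fin M', kemb blk k M' h l = i := by
  have hm : i ∈ ((univ.filter fun i => blk i ≠ k) : Set (Fin M)) := by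
    simp [hi]
  unfold kemb
  rw [← Finset.range_orderEmbOfFin _ h] at hm
  exact hm

/-! ## Block sizes after deleting block `k` -/

/-- Block `k` is empty one block down. -/
theorem bsize_kemb_self (blk : Fin M → Fin n) (k : Fin n) (h : (univ.filter fun i => blk i ≠ k).card = M') :
    bsize (blk ∘ kemb blk k M' h) k = 0 := by
  unfold bsize
  rw [Finset.card_eq_zero, Finset.filter_eq_empty_iff]
  intro l _
  exact blk_kemb_ne blk k h l

/-- The other blocks keep their size. -/
theorem bsize_kemb_of_ne (blk : Fin M → Fin n) (k : Fin n) (h : (univ.filter fun i => blk i ≠ k).card = M') (j : Fin n)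
    (hj : j ≠ k) : bsize (blk ∘ kemb blk k M' h) j = bsize blk j := by
  unfold bsize
  have hset : (univ.filter fun i : Fin M => blk i = j) =
      (univ.filter fun l : Fin M' => (blk ∘ kemb blk k M' h) l = j).map (kemb blk k M' h).toEmbedding := by
    ext i
    simp only [Finset.mem_filter, Finset.mem_univ, true_and, Finset.mem_map, Function.comp_apply,
      RelEmbedding.coe_toEmbedding]
    constructor
    · intro hij
      obtain ⟨l, hl⟩ := exists_kemb_eq blk k h i (by rw [hij]; exact hj)
      exact ⟨l, by rw [hl]; exact hij, hl⟩
    · rintro ⟨l, hl, rfl⟩; exact hl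
  rw [hset, Finset.card_map]

/-- The dimension offsets: `Σ_j (bsize blk j − 1) = Σ_j (bsize' j − 1) + bsize blk k`. -/
theorem sum_bsize_sub_one_kemb (blk : Fin M → Fin n) (k : Fin n) (h : (univ.filter fun i => blk i ≠ k).card = M') :
    ∑ j : Fin n, ((bsize blk j : ℤ) - 1) =
      ∑ j : Fin n, ((bsize (blk ∘ kemb blk k M' h) j : ℤ) - 1) + (bsize blk k : ℤ) := by
  rw [← Finset.add_sum_erase univ _ (Finset.mem_univ k), ← Finset.add_sum_erase univ
    (fun j => ((bsize (blk ∘ kemb blk k M' h) j : ℤ) - 1)) (Finset.mem_univ k), bsize_kemb_self blk k h]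
  have hrest : ∑ j ∈ univ.erase k, ((bsize blk j : ℤ) - 1) =
      ∑ j ∈ univ.erase k, ((bsize (blk ∘ kemb blk k M' h) j : ℤ) - 1) := by
    refine Finset.sum_congr rfl fun j hj => ?_
    rw [bsize_kemb_of_ne blk k h j (Finset.ne_of_mem_erase hj)]
  rw [hrest]
  push_cast
  ring

/-! ## Zero patterns after deleting block `k` -/

/-- Block `j ≠ k` one block down: the zero pattern is unchanged. -/
theorem blockZero_kemb_iff_of_ne (blk : Fin M → Fin n) (k : Fin n) (h : (univ.filter fun i => blk i ≠ k).card = M')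
    (j : Fin n) (hj : j ≠ k) (y : Fin M → ZMod 2) :
    (∀ l : Fin M', (blk ∘ kemb blk k M' h) l = j → (fun l' => y (kemb blk k M' h l')) l = 0) ↔
      (∀ i, blk i = j → y i = 0) := by
  simp only [Function.comp_apply]
  constructor
  · intro hl i hij
    obtain ⟨l, hl'⟩ := exists_kemb_eq blk k h i (by rw [hij]; exact hj)
    rw [← hl']
    exact hl l (by rw [hl']; exact hij)
  · intro hi l hl
    exact hi _ hl

/-- Block `k` of a member point is empty, so its zero condition is vacuous. -/
theorem blockZero_kemb_self (blk : Fin M → Fin n) (k : Fin n) (h : (univ.filter fun i => blk i ≠ k).card = M')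
    (x : Fin M' → ZMod 2) : ∀ l : Fin M', (blk ∘ kemb blk k M' h) l = k → x l = 0 :=
  fun l hl => absurd hl (blk_kemb_ne blk k h l)

/-- `Σ_{S ∈ L} |S| = |Y|` for a block layer family. -/
theorem sum_card_blk (blk : Fin M → Fin n) (Y : Finset (Fin M → ZMod 2)) (k : Fin n)
    (h : (univ.filter fun i => blk i ≠ k).card = M') (L : List (Finset (Fin M' → ZMod 2)))
    (hL : IsBLayerFamily blk Y k M' h L) : (L.map fun S => (S.card : ℤ)).sum = (Y.card : ℤ) := by
  have h' := list_sum_card_filter_eq (fun y : Fin M → ZMod 2 => fun l' => y (kemb blk k M' h l')) Y L hL (fun _ => True)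
  simp only [Finset.filter_true_of_mem (fun _ _ => trivial)] at h'
  exact h'

/-- `Σ_{S ∈ L} Z_k(S) = |Y|`: block `k` of every member point is empty. -/
theorem sum_zcount_blk_self (blk : Fin M → Fin n) (Y : Finset (Fin M → ZMod 2)) (k : Fin n)
    (h : (univ.filter fun i => blk i ≠ k).card = M') (L : List (Finset (Fin M' → ZMod 2)))
    (hL : IsBLayerFamily blk Y k M' h L) :
    (L.map fun S => (zcount (blk ∘ kemb blk k M' h) k S : ℤ)).sum = (Y.card : ℤ) := by
  rw [← sum_card_blk blk Y k h L hL]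
  congr 1
  refine List.map_congr_left fun S _ => ?_
  unfold zcount
  rw [Finset.filter_true_of_mem fun x _ => blockZero_kemb_self blk k h x]

/-- `Σ_{S ∈ L} Z_j(S) = Z_j(Y)` for `j ≠ k`. -/
theorem sum_zcount_blk_of_ne (blk : Fin M → Fin n) (Y : Finset (Fin M → ZMod 2)) (k : Fin n)
    (h : (univ.filter fun i => blk i ≠ k).card = M') (L : List (Finset (Fin M' → ZMod 2)))
    (hL : IsBLayerFamily blk Y k M' h L) (j : Fin n) (hj : j ≠ k) :
    (L.map fun S => (zcount (blk ∘ kemb blk k M' h) j S : ℤ)).sum = (zcount blk j Y : ℤ) := by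
  unfold zcount
  rw [list_sum_card_filter_eq (fun y : Fin M → ZMod 2 => fun l' => y (kemb blk k M' h l')) Y L hL]
  congr 2
  exact Finset.filter_congr fun y _ => blockZero_kemb_iff_of_ne blk k h j hj y

end Summit.PneNP.PneNP.Theorems.ClusCoordBookBlk

namespace Summit.PneNP.PneNP.Theorems.ClusCoord

open Finset
open Summit.PneNP.PneNP.Theorems.ClusCoordBook (list_sum_map_finset_sum list_sum_map_le list_sum_map_sub list_sum_map_mul)
open Summit.PneNP.PneNP.Theorems.ClusCoordBookBlk

/-- **Registered stub `stub_cBookBlk` of path `coord` (PEEL form)** (stmt-PneNP-19683): block-layer bookkeeping — if a block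
layer family satisfies the block layer inequality and every member satisfies the mixed certificate one block down (blocks
`blk ∘ kemb`, block `k` now empty), then `Y` satisfies it (`Σ_S Z_j(S) = Z_j(Y)` for `j ≠ k`; `Z_k(S) = |S|` with weight `2^0`
and `Σ_S |S| = |Y|`; `Σ_j (bsize j − 1)` drops by `bsize k`; then `linarith`). -/
theorem stub_cBookBlk : ∀ M M' n : ℕ, ∀ blk : Fin M → Fin n, ∀ Y : Finset (Fin M → ZMod 2), ∀ k : Fin n,
    ∀ h : (univ.filter fun i => blk i ≠ k).card = M', ∀ L : List (Finset (Fin M' → ZMod 2)),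
    IsBLayerFamily blk Y k M' h L → BLayerIneq M n blk Y k M' L →
    (∀ S ∈ L, UCMix M' n (blk ∘ kemb blk k M' h) S) → UCMix M n blk Y := by
  intro M M' n blk Y k h L hfam hineq hmem
  set blk' : Fin M' → Fin n := blk ∘ kemb blk k M' h with hblk'
  set B' : ℤ := ∑ j : Fin n, ((bsize blk' j : ℤ) - 1) with hB'
  -- the members' certificates: `dsum M' S − B'|S| ≤ Σ_j 2^{bsize' j} Z_j(S)`
  have hmem' : ∀ S ∈ L, dsum M' S - B' * (S.card : ℤ) ≤
      ∑ j : Fin n, (2 : ℤ) ^ (bsize blk' j) * (zcount blk' j S : ℤ) := by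
    intro S hS
    have h1 := hmem S hS
    unfold UCMix at h1
    unfold dsum
    rw [Finset.sum_sub_distrib, Finset.sum_const, nsmul_eq_mul] at h1
    linarith
  -- summed over the family: `Σ_S dsum S − B'|Y| ≤ Σ_j 2^{bsize' j} (Σ_S Z_j(S))`
  have hsum : (L.map (dsum M')).sum - B' * (Y.card : ℤ) ≤
      ∑ j : Fin n, (2 : ℤ) ^ (bsize blk' j) * (L.map fun S => (zcount blk' j S : ℤ)).sum := by
    have h1 := list_sum_map_le L _ _ hmem'
    rw [list_sum_map_sub, list_sum_map_mul, sum_card_blk blk Y k h L hfam, list_sum_map_finset_sum] at h1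
    refine h1.trans (le_of_eq (Finset.sum_congr rfl fun j _ => ?_))
    rw [list_sum_map_mul]
  -- evaluate the right-hand side: block `k` gives `|Y|`, the other blocks give `2^{bsize j} Z_j(Y)`
  have hrhs : ∑ j : Fin n, (2 : ℤ) ^ (bsize blk' j) * (L.map fun S => (zcount blk' j S : ℤ)).sum =
      (Y.card : ℤ) + ∑ j ∈ univ.erase k, (2 : ℤ) ^ (bsize blk j) * (zcount blk j Y : ℤ) := by
    rw [← Finset.add_sum_erase univ _ (Finset.mem_univ k)]
    rw [hblk', bsize_kemb_self blk k h, sum_zcount_blk_self blk Y k h L hfam, pow_zero, one_mul]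
    congr 1
    refine Finset.sum_congr rfl fun j hj => ?_
    rw [bsize_kemb_of_ne blk k h j (Finset.ne_of_mem_erase hj),
      sum_zcount_blk_of_ne blk Y k h L hfam j (Finset.ne_of_mem_erase hj)]
  rw [hrhs] at hsum
  -- the block layer inequality
  unfold BLayerIneq at hineq
  -- the goal, with `dsum` and the offsets `B = B' + bsize k`
  unfold UCMix
  rw [Finset.sum_sub_distrib, Finset.sum_const, nsmul_eq_mul, sum_bsize_sub_one_kemb blk k h,
    ← Finset.add_sum_erase univ (fun j => (2 : ℤ) ^ (bsize blk j) * (zcount blk j Y : ℤ)) (Finset.mem_univ k)]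
  change dsum M Y - _ ≤ _
  rw [← hblk', ← hB']
  linarith

end Summit.PneNP.PneNP.Theorems.ClusCoord
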